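import Mathlib.Analysis.Calculus.ContDiff.Bounds
import Mathlib.Analysis.SpecialFunctions.ExpDeriv
import Mathlib.Analysis.SpecialFunctions.Pow.Real
import HarnessLib

/-!
# S6-EXPVERTEX: the Boltzmann atom factor `e^{−V}` has a derivative table with AT LEAST ONE VERTEX LEG —
# `‖Dⁿ(e^{−V})(φ)‖ ≤ n!·e^{−V(φ)}·d` (`n ≥ 1`) whenever `‖DⁱV(φ)‖ ≤ d ≤ 1` for `1 ≤ i ≤ n` (Faà di Bruno with the ratio `D := d^{1∕n}`)

Cell `ym3-torus` (YM ladder rung R3 = continuum `SU(2)` Yang–Mills on the three-torus — a RUNG, NOT d = 4, NOT infinite volume, NOT a mass gap, NOT Clay).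
Width seat `ym3-torus-px20` (gen 16); `--supports stmt-QuantumFields-20520 --as helper`, count-neutral, definition-free, default heartbeats; registry v11.4 №36
untouched.  BLUEPRINT-ECE₁ S6: GBND ∕ (GB-an) (✓`AnchorGap.ActBound.abs_gaussExpect_foldl_dop_prod_le`, any table `S b n`) turn a DERIVATIVE TABLE of the atom factors into the
Kotecký–Preiss majorant; the KP smallness (`Nf λ → 0`, `τ₁ ≤ Φ J`) needs every differentiated atom factor to carry at least one power of the vertex size `d = O((√β_λ)⁻¹)`
(✓`…LoopLedgerVertexScaling.vertex_table_of_jet`).  Mathlib's Faà di Bruno bound `norm_iteratedFDeriv_comp_le` (`‖Dⁿ(g∘f)‖ ≤ n!·C·Dⁿ` from `‖Dⁱg‖ ≤ C`, `‖Dⁱf‖ ≤ Dⁱ`) gives exactly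
that for `g = exp` with the choice `D := d^{1∕n}` (`d ≤ 1 ⇒ d ≤ d^{i∕n}` for `i ≤ n`, and `Dⁿ = d`):
* §1 `iteratedFDeriv_exp_eq`, `norm_iteratedFDeriv_exp_le` (all derivatives of `Real.exp` at `y` have norm `≤ e^{y}`), `rpow_inv_natCast_pow` & `le_rpow_inv_natCast_pow_of_le_one`
  (the `d^{1∕n}` bookkeeping).
* §2 ★★`norm_iteratedFDeriv_exp_comp_le` — `ContDiff ℝ N f`, `1 ≤ n ≤ N`, `0 ≤ d ≤ 1`, `∀ i, 1 ≤ i → i ≤ n → ‖iteratedFDeriv ℝ i f x‖ ≤ d` ⟹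
  `‖iteratedFDeriv ℝ n (fun x => Real.exp (f x)) x‖ ≤ n ! * Real.exp (f x) * d`; ★`norm_iteratedFDeriv_exp_neg_comp_le` (the `e^{−V}` spelling); order `0`
  (`|e^{−V} − 1| ≤ 2|V|` for `|V| ≤ 1`) is ALREADY lit ✓`BIJ88Sect5Statements.abs_exp_neg_sub_one_le` ∕ Mathlib `Real.abs_exp_sub_one_le` — not restated.

HONEST SCOPE.  [folklore] Faà di Bruno bookkeeping; nothing of the vertex bounds themselves (FILE `…VertexScaling`), of the cut (S3), of GREP∕GBND's assembly, of S7, of Bałaban's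
expansions, of GAS∕GAS₁∕REP∕H4ᶜ∕S2β or of `FluctuationComparisonRegPrIntL` (stmt-QuantumFields-20520) is proved; no summit statement is proved by a helper; rung R3 = SU(2) YM₃ on T³ —
NOT d = 4, NOT infinite volume, NOT a mass gap, NOT Clay; the Yang–Mills mass gap is NOT proved.

References: D. C. Brydges, *A short course on cluster expansions*, Les Houches 1984 [Brydges1986] §3; G. Benfatto, A. Giuliani, V. Mastropietro, AHP **7** (2006)
[BenfattoGiulianiMastropietro2006]; T. Bałaban, CMP **102** (1985) 255–275 [Balaban1985UV3] ((45)–(47)).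
-/

set_option autoImplicit false

noncomputable section

open scoped Nat

namespace Summit.QuantumFields.YangMills.Theorems.LoopLedgerExpVertexTable

variable {E : Type*} [NormedAddCommGroup E] [NormedSpace ℝ E]

/-! ## §1 The derivatives of `exp` and the `d^{1∕n}` bookkeeping -/

/-- every iterated derivative of `Real.exp` at `y` has norm at most `e^{y}`: `‖Dⁱ exp (y)‖ ≤ e^{y}` (the `i`-th Fréchet derivative of a function `ℝ → ℝ` has the norm of
its `i`-th ordinary derivative, Mathlib `norm_iteratedFDeriv_eq_norm_iteratedDeriv`, and `iteratedDeriv i exp = exp`). [folklore] -/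
theorem norm_iteratedFDeriv_exp_le (i : ℕ) (y : ℝ) : ‖iteratedFDeriv ℝ i Real.exp y‖ ≤ Real.exp y := by
  rw [norm_iteratedFDeriv_eq_norm_iteratedDeriv, iteratedDeriv_eq_iterate, Real.iter_deriv_exp, Real.norm_eq_abs, abs_of_pos (Real.exp_pos y)]

/-- `(d^{1∕n})ⁿ = d` for `d ≥ 0`, `n ≥ 1`. [folklore] -/
theorem rpow_inv_natCast_pow {d : ℝ} (hd : 0 ≤ d) {n : ℕ} (hn : 1 ≤ n) : (d ^ ((n : ℝ)⁻¹)) ^ n = d := by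
  rw [← Real.rpow_natCast, ← Real.rpow_mul hd, inv_mul_cancel₀ (by exact_mod_cast (by omega : n ≠ 0)), Real.rpow_one]

/-- `d ≤ (d^{1∕n})ⁱ` for `0 ≤ d ≤ 1` and `i ≤ n`, `1 ≤ n`: the small ratio's powers dominate `d` up to order `n`. [folklore] -/
theorem le_rpow_inv_natCast_pow_of_le_one {d : ℝ} (hd : 0 ≤ d) (hd1 : d ≤ 1) {i n : ℕ} (hn : 1 ≤ n) (hi : i ≤ n) :
    d ≤ (d ^ ((n : ℝ)⁻¹)) ^ i := by
  have hn0 : (0 : ℝ) < n := by exact_mod_cast hn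
  rcases hd.eq_or_lt with h0 | hpos
  · rw [← h0]
    exact pow_nonneg (Real.rpow_nonneg le_rfl _) _
  rw [← Real.rpow_natCast, ← Real.rpow_mul hd]
  have hexp : (n : ℝ)⁻¹ * (i : ℝ) ≤ 1 := by
    rw [inv_mul_le_iff₀ hn0, mul_one]
    exact_mod_cast hi
  calc d = d ^ (1 : ℝ) := (Real.rpow_one d).symm
    _ ≤ d ^ ((n : ℝ)⁻¹ * (i : ℝ)) := Real.rpow_le_rpow_of_exponent_ge hpos hd1 hexp

/-! ## §2 The atom-factor table with one vertex leg -/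

/-- ★★ **one vertex leg per differentiated Boltzmann factor.**  If `f` is `Cᴺ`, `1 ≤ n ≤ N`, and at the point `x` all the jets `‖Dⁱf(x)‖ ≤ d` (`1 ≤ i ≤ n`) with `0 ≤ d ≤ 1`,
then `‖Dⁿ(e^{f})(x)‖ ≤ n!·e^{f(x)}·d` — Mathlib's Faà di Bruno bound `norm_iteratedFDeriv_comp_le` with `C := e^{f x}` (§1) and the ratio `D := d^{1∕n}`. [folklore] -/
theorem norm_iteratedFDeriv_exp_comp_le {f : E → ℝ} {N : WithTop ℕ∞} (hf : ContDiff ℝ N f) {n : ℕ} (hn1 : 1 ≤ n) (hnN : (n : WithTop ℕ∞) ≤ N)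
    (x : E) {d : ℝ} (hd : 0 ≤ d) (hd1 : d ≤ 1) (hD : ∀ i, 1 ≤ i → i ≤ n → ‖iteratedFDeriv ℝ i f x‖ ≤ d) :
    ‖iteratedFDeriv ℝ n (fun x => Real.exp (f x)) x‖ ≤ n ! * Real.exp (f x) * d := by
  have hcomp : (fun x => Real.exp (f x)) = Real.exp ∘ f := rfl
  rw [hcomp]
  have h := norm_iteratedFDeriv_comp_le (Real.contDiff_exp.of_le le_top) hf hnN x (C := Real.exp (f x)) (D := d ^ ((n : ℝ)⁻¹))
    (fun i _ => norm_iteratedFDeriv_exp_le i (f x)) (fun i hi1 hi2 => (hD i hi1 hi2).trans (le_rpow_inv_natCast_pow_of_le_one hd hd1 hn1 hi2))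
  rwa [rpow_inv_natCast_pow hd hn1] at h

/-- ★ the `e^{−V}` spelling: `‖DⁱV(x)‖ ≤ d ≤ 1` for `1 ≤ i ≤ n` ⟹ `‖Dⁿ(e^{−V})(x)‖ ≤ n!·e^{−V(x)}·d` (the jets of `−V` have the same norms). [folklore] -/
theorem norm_iteratedFDeriv_exp_neg_comp_le {V : E → ℝ} {N : WithTop ℕ∞} (hV : ContDiff ℝ N V) {n : ℕ} (hn1 : 1 ≤ n) (hnN : (n : WithTop ℕ∞) ≤ N)
    (x : E) {d : ℝ} (hd : 0 ≤ d) (hd1 : d ≤ 1) (hD : ∀ i, 1 ≤ i → i ≤ n → ‖iteratedFDeriv ℝ i V x‖ ≤ d) :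
    ‖iteratedFDeriv ℝ n (fun z => Real.exp (-V z)) x‖ ≤ n ! * Real.exp (-V x) * d := by
  refine norm_iteratedFDeriv_exp_comp_le (f := fun z => -V z) hV.neg hn1 hnN x hd hd1 fun i hi1 hi2 => ?_
  have hneg : (fun z => -V z) = -V := rfl
  rw [hneg, iteratedFDeriv_neg_apply, norm_neg]
  exact hD i hi1 hi2

end Summit.QuantumFields.YangMills.Theorems.LoopLedgerExpVertexTable

end
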